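import Mathlib
import Summits.Ventures.HodgeRepro.ConjDualConductorParity
import Summits.Ventures.HodgeRepro.PeriodCloserC7Stability

/-!
# OcticCMPointRamifiedTower — the rings `𝒪/𝔭^{4k}` at `𝔭 | 5` of the octic point for EVERY `k`, and the
conductor parity of conjugate-dual characters at every level

Blind re-derivation cell `pub-hodge-repro`, seat night-2 (gen 6).  Target tree path
`lean/Summits/Ventures/HodgeRepro/OcticCMPointRamifiedTower.lean`.  Gen 5's `OcticCMPointEightModel` is the level
`k = 2` of the tower

  **`Rk k = 𝒪/𝔭^{4k} = ℤ/5^k[w]/(w⁴ + 5w² + 5)`**, `w = ϖ = ζ₅ − ζ₅⁻¹`, `𝔭 = (w)`,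

(`K_v = ℚ₅(ζ₅)`, `𝒪 = ℤ₅[ϖ]`, `X⁴ + 5X² + 5` Eisenstein; `w⁴ = −5(1 + w²)` with `1 + w²` a unit, so
`𝔭^{4k} = (5^k)` and `𝒪/𝔭^{4k} = ℤ/5^k[w]/(w⁴ + 5w² + 5)`; `w^{4k} = 0` — `w_pow_eq_zero`).  The conjugation of
`K_v / k_v` (`k_v = ℚ₅(√5)`, `σ(ζ₅) = ζ₅⁻¹`) is `σ : w ↦ −w` (`conj`, the polynomial is even), `2` is a unit
(`isUnit_two`), and `σ x ≡ x mod w` for every `x` (`conj_sub_self`: the odd part of a polynomial in `w` is divisible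
by `w` — proved for ANY `AdjoinRoot` with a conjugation sending the root to its negative, `AdjoinRoot.conj_sub_self`).

So the hypotheses of `ConjDualConductorParity` hold at every level, and **for every `k`, every conjugate-dual
character of `(𝒪/𝔭^{4k})^×` has even conductor or conductor `≤ 1`** (`conjDual_conductor_even_or_le_one`,
`conjDual_trivialOn_even_of_odd`; the `LocalChar` forms `localChar_conjDual_conductor_even_or_le_one`,
`localChar_conjDual_trivialOn_even_of_odd`).  Since a character of conductor `c` factors through `𝒪/𝔭^{4k}` as soon
as `4k ≥ c`, this is the statement for EVERY conductor: gen 5's honest limit «`c > 8` at `𝔭 | 5`» is closed for the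
odd conductors — the odd rows of the root-number table at the ramified places are empty at every level.

**What this is not.**  The even conductors `> 8` (their root numbers need the stationary phase on `Rk k` with a
primitive `σ`-odd additive character — `ψ_{5^k} ∘ top` — and the `σ`-fixed residues, NOT built here), the
identification `Rk k ≅ 𝒪/𝔭^{4k}` (elementary, as in `OcticCMPointEightModel`), and any global statement are NOT
here.  Nothing here says anything about the status of the Hodge conjecture for CM abelian varieties, which is NOT
proved.
-/

set_option autoImplicit false

noncomputable section

open Polynomial Classical

namespace Summit.Ventures.HodgeRepro.PeriodCloser

/-! ### A conjugation of `AdjoinRoot g` sending the root to its negative is the identity modulo the root -/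

namespace AdjoinRootConj

variable {A : Type} [CommRing A] (g : A[X])

/-- For an algebra endomorphism `σ` of `A[X]/(g)` with `σ(root) = −root`, `σ(mk p) = mk (p(−X))`. -/
theorem map_mk (σ : AdjoinRoot g →ₐ[A] AdjoinRoot g) (hσ : σ (AdjoinRoot.root g) = -AdjoinRoot.root g)
    (p : A[X]) : σ (AdjoinRoot.mk g p) = AdjoinRoot.mk g (p.comp (-X)) := by
  rw [← AdjoinRoot.aeval_eq, ← AdjoinRoot.aeval_eq, aeval_comp, ← aeval_algHom_apply, hσ]
  simp only [map_neg, aeval_X]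

/-- `p(−X) − p(X)` has no constant term, so it is divisible by `X`. -/
theorem X_dvd_comp_neg_sub (p : A[X]) : X ∣ p.comp (-X) - p := by
  rw [X_dvd_iff, coeff_sub, coeff_zero_eq_eval_zero, coeff_zero_eq_eval_zero, eval_comp, eval_neg, eval_X,
    neg_zero, sub_self]

/-- **`σ x ≡ x` modulo the root** for every `x` of `A[X]/(g)`: `σ` induces the identity on `A[X]/(g, X)`. -/
theorem conj_sub_self (σ : AdjoinRoot g →ₐ[A] AdjoinRoot g) (hσ : σ (AdjoinRoot.root g) = -AdjoinRoot.root g)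
    (x : AdjoinRoot g) : ∃ y, σ x - x = AdjoinRoot.root g * y := by
  refine AdjoinRoot.induction_on (f := g) x fun p => ?_
  obtain ⟨q, hq⟩ := X_dvd_comp_neg_sub p
  refine ⟨AdjoinRoot.mk g q, ?_⟩
  rw [map_mk g σ hσ, ← map_sub, hq, map_mul, AdjoinRoot.mk_X]

end AdjoinRootConj

/-! ### The tower `Rk k = ℤ/5^k[w]/(w⁴ + 5w² + 5)` -/

namespace RamifiedTower

open ConductorParity

variable (k : ℕ)

/-- The minimal polynomial `X⁴ + 5X² + 5` of `ϖ = ζ₅ − ζ₅⁻¹`, over `ℤ/5^k`. -/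
def f : (ZMod (5 ^ k))[X] := X ^ 4 + 5 * X ^ 2 + 5

/-- **The ring `𝒪/𝔭^{4k} = ℤ/5^k[w]/(w⁴ + 5w² + 5)`** (level `k` of the tower; `k = 2` is `OcticCMPointEightModel.R8`). -/
abbrev Rk : Type := AdjoinRoot (f k)

/-- The uniformiser `w = ϖ` at level `k`. -/
abbrev w : Rk k := AdjoinRoot.root (f k)

/-- `aeval y f` in closed form. -/
theorem aeval_f (y : Rk k) : aeval y (f k) = y ^ 4 + 5 * y ^ 2 + 5 := by
  show aeval y (X ^ 4 + 5 * X ^ 2 + 5) = _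
  simp only [map_add, map_mul, map_pow, aeval_X, map_ofNat]

/-- The defining relation `w⁴ + 5w² + 5 = 0`. -/
theorem w_rel : w k ^ 4 + 5 * w k ^ 2 + 5 = 0 := by
  rw [← aeval_f, AdjoinRoot.aeval_eq, AdjoinRoot.mk_self]

/-- `5^k = 0` in `Rk k`. -/
theorem five_pow_eq_zero : (5 : Rk k) ^ k = 0 := by
  have h : ((5 ^ k : ℕ) : ZMod (5 ^ k)) = 0 := ZMod.natCast_self _
  rw [Nat.cast_pow, Nat.cast_ofNat] at h
  rw [show (5 : Rk k) = algebraMap (ZMod (5 ^ k)) (Rk k) 5 from (map_ofNat _ 5).symm, ← map_pow, h, map_zero]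

/-- `w^{4k} = 0`: `𝔭^{4k} = (5^k) = 0` (`w⁴ = −5(1 + w²)`). -/
theorem w_pow_eq_zero : w k ^ (4 * k) = 0 := by
  have h4 : w k ^ 4 = -5 * (1 + w k ^ 2) := by linear_combination w_rel k
  rw [pow_mul, h4, mul_pow, neg_pow, five_pow_eq_zero, mul_zero, zero_mul]

/-- `w` is nilpotent. -/
theorem isNilpotent_w : IsNilpotent (w k) := ⟨4 * k, w_pow_eq_zero k⟩

/-- `2` is a unit of `ℤ/5^k`, hence of `Rk k`. -/
theorem isUnit_two : IsUnit (2 : Rk k) := by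
  have hc : Nat.Coprime 2 (5 ^ k) := Nat.Coprime.pow_right k (by decide)
  have hu : IsUnit (2 : ZMod (5 ^ k)) := by
    have := (ZMod.unitOfCoprime 2 hc).isUnit
    rwa [ZMod.coe_unitOfCoprime, Nat.cast_ofNat] at this
  have := hu.map (algebraMap (ZMod (5 ^ k)) (Rk k))
  rwa [map_ofNat] at this

/-! ### The conjugation `σ : w ↦ −w` -/

/-- `−w` is a root of `f` (the polynomial is even). -/
theorem aeval_neg_w : aeval (-w k) (f k) = 0 := by
  rw [aeval_f]
  linear_combination w_rel k

/-- The root condition in the form `liftAlgHom` wants. -/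
theorem eval₂_of_aeval {y : Rk k} (h : aeval y (f k) = 0) :
    (f k).eval₂ ((Algebra.ofId (ZMod (5 ^ k)) (Rk k) : ZMod (5 ^ k) →ₐ[ZMod (5 ^ k)] Rk k) :
      ZMod (5 ^ k) →+* Rk k) y = 0 := by
  show eval₂ (algebraMap (ZMod (5 ^ k)) (Rk k)) y (f k) = 0
  rw [← Polynomial.aeval_def]
  exact h

/-- **The conjugation `σ : w ↦ −w`** of `K_v / k_v` on `𝒪/𝔭^{4k}`, a `ℤ/5^k`-algebra endomorphism. -/
def conj : Rk k →ₐ[ZMod (5 ^ k)] Rk k :=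
  AdjoinRoot.liftAlgHom (f k) (Algebra.ofId (ZMod (5 ^ k)) (Rk k)) (-w k) (eval₂_of_aeval k (aeval_neg_w k))

/-- `σ(w) = −w`. -/
theorem conj_w : conj k (w k) = -w k := AdjoinRoot.liftAlgHom_root _ _ _ _

/-- `σ` is an involution. -/
theorem conj_conj (y : Rk k) : conj k (conj k y) = y := by
  have h : (conj k).comp (conj k) = AlgHom.id (ZMod (5 ^ k)) (Rk k) := by
    apply AdjoinRoot.algHom_ext
    rw [AlgHom.comp_apply, conj_w, map_neg, conj_w, neg_neg, AlgHom.id_apply]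
  exact AlgHom.congr_fun h y

/-- `σ` as a ring homomorphism. -/
def σ : Rk k →+* Rk k := (conj k).toRingHom

/-- `σ y = conj y`. -/
theorem σ_apply (y : Rk k) : σ k y = conj k y := rfl

/-- `σ(w) = −w` for the ring homomorphism. -/
theorem σ_w : σ k (w k) = -w k := conj_w k

/-- **`σ x ≡ x` modulo `w`** for every `x` (`σ` is the identity on the residue field `𝔽₅`). -/
theorem conj_sub_self (x : Rk k) : ∃ y, σ k x - x = w k * y :=
  AdjoinRootConj.conj_sub_self (f k) (conj k) (conj_w k) x

/-! ### Conductor parity at every level -/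

/-- Every character of `Rk k` is trivial on `1 + w^{4k} Rk k = {1}`, so its conductor is defined. -/
theorem exists_trivialOn (ρ : MulChar (Rk k) ℂ) : ∃ c, TrivialOn ρ (w k) c :=
  ⟨4 * k, trivialOn_of_pow_eq_zero ρ (w_pow_eq_zero k)⟩

/-- **Parity at level `k`**: a conjugate-dual character of `(𝒪/𝔭^{4k})^×` trivial on `1 + 𝔭^{2m+1}`, `m ≥ 1`, is
trivial on `1 + 𝔭^{2m}`. -/
theorem conjDual_trivialOn_even_of_odd (ρ : MulChar (Rk k) ℂ) (hσ : ConjDual (σ k) ρ) {m : ℕ} (hm : 1 ≤ m)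
    (h : TrivialOn ρ (w k) (2 * m + 1)) : TrivialOn ρ (w k) (2 * m) :=
  ConjDual.trivialOn_even_of_odd (σ k) (w k) (σ_w k) (conj_sub_self k) (isUnit_two k) (isNilpotent_w k) hσ hm h

/-- **The conductor of a conjugate-dual character of `(𝒪/𝔭^{4k})^×` is even or `≤ 1`, for every `k`.** -/
theorem conjDual_conductor_even_or_le_one (ρ : MulChar (Rk k) ℂ) (hσ : ConjDual (σ k) ρ) :
    conductor ρ (w k) (exists_trivialOn k ρ) ≤ 1 ∨ Even (conductor ρ (w k) (exists_trivialOn k ρ)) :=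
  ConjDual.conductor_even_or_le_one (σ k) (w k) (σ_w k) (conj_sub_self k) (isUnit_two k) (isNilpotent_w k) hσ _

/-- The conductor of a conjugate-dual character at level `k` is never an odd number `≥ 3`. -/
theorem conjDual_conductor_ne_odd (ρ : MulChar (Rk k) ℂ) (hσ : ConjDual (σ k) ρ) (m : ℕ) (hm : 1 ≤ m) :
    conductor ρ (w k) (exists_trivialOn k ρ) ≠ 2 * m + 1 :=
  ConjDual.conductor_ne_odd (σ k) (w k) (σ_w k) (conj_sub_self k) (isUnit_two k) (isNilpotent_w k) hσ _ m hm

/-- The same for a local character in gen 1's form (`ρ.unit ∘ conj = ρ.unit⁻¹`): trivial on `1 + 𝔭^{2m+1}` forces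
trivial on `1 + 𝔭^{2m}`, `m ≥ 1`. -/
theorem localChar_conjDual_trivialOn_even_of_odd (ρ : LocalChar (Rk k))
    (hσ : ∀ x, ρ.unit (conj k x) = ρ.unit⁻¹ x) {m : ℕ} (hm : 1 ≤ m)
    (h : ∀ y, ρ.unit (1 + w k ^ (2 * m + 1) * y) = 1) : ∀ s, ρ.unit (1 + w k ^ (2 * m) * s) = 1 :=
  conjDual_trivialOn_even_of_odd k ρ.unit (fun x => hσ x) hm h

/-- The conductor of a conjugate-dual local character at level `k` is even or `≤ 1`. -/
theorem localChar_conjDual_conductor_even_or_le_one (ρ : LocalChar (Rk k))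
    (hσ : ∀ x, ρ.unit (conj k x) = ρ.unit⁻¹ x) :
    conductor ρ.unit (w k) (exists_trivialOn k ρ.unit) ≤ 1 ∨
      Even (conductor ρ.unit (w k) (exists_trivialOn k ρ.unit)) :=
  conjDual_conductor_even_or_le_one k ρ.unit (fun x => hσ x)

end RamifiedTower

end Summit.Ventures.HodgeRepro.PeriodCloser

end
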